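import Summits.ABC.ABC.Theses.FeketeScales
import Summits.ABC.ABC.Theorems.FeketeScalesAssembly

/-!
# Near-good propagation (NAP): the iteration lemmas, and crux ⟹ NAP

Crux `stmt-ABC-2160`, decl `Summit.ABC.ABC.Theses.FeketeScales.ScaleSubmultiplicativity`, route
`FeketeScales` (ABC/ABC); lead c6 helper (`--supports`), part 1 of 2 answering the crux-strategist's
route-level finding R4 (`Cruxes/ScaleSubmultiplicativity/STRATEGY-CENSUS.md`, seat s1, 2026-08-17): the
route's Assembly uses the crux only to propagate goodness of two scales to their product, and only at
scales already NEAR-good with ONE common exponent.  That weaker hypothesis is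

`NAP := ∃ δ₀ > 0, ∃ θ < 1, ∃ K > 0, ∃ R₀, ∀ R₁ R₂ ≥ R₀, ∀ l ∈ [1, 1 + δ₀],
   Good R₁ (R₁^l) → Good R₂ (R₂^l) → Good (R₁R₂) (K e^{(log R₁R₂)^θ} (R₁R₂)^l)`,

`Good S X` meaning "every abc triple of radical `≤ S` has `c ≤ X`" (inlined; the strategist's companion
`StrategistS1.lean` has it as a `def`).  This file:

* abstract iteration lemmas for a predicate `P S X` under a near-good propagation hypothesis with slack
  `e^L e^{(log S₁S₂)^θ}` (`0 ≤ θ ≤ 1`, `L ≥ 0`) — `chain_exact` / `chain` (from a `(1+δ)`-good seed `R`,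
  `P (R^{k+1}) ((R^{k+1})^{1+δ+kΔ})`, `Δ = (L + (log R)^θ)/log R`, by NAP at `(R^{k+1}, R)`), `tower` (the
  doubling potential of `FeketeScalesAssembly.doubling` run with one exponent:
  `P (B^{2^i}) ((B^{2^i})^{b₀ + β/log B})` when `L + 2^θ (log B)^θ ≤ β (2 - 2^θ)`), `cover` (every
  `N ≥ M ≥ 1` has `N ≤ m 2^i ≤ N + N/M` with `M ≤ m ≤ 2M`), `slack_le_linear` (`L + A t^θ ≤ κ t`
  eventually), `nap_normalise` (`θ ↦ max θ 0`, `K ↦ e^{max (log K) 0}`, thresholds `≥ 2`); every NAP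
  application carries the window side-conditions `1 ≤ l ≤ 1 + δ₀`;
* `ScaleSubmultiplicativity.nap_of_scaleSubmultiplicativity` : crux → NAP (every window; the shadows are
  bounded by the goodness bounds).

Part 2 (`FeketeScalesScaleSubmultiplicativityNapAssembly.lean`) proves the strategist's `NapAssembly`:
NAP → SparseGoodScales → ABC.

References: `Cruxes/ScaleSubmultiplicativity/STRATEGY-CENSUS.md` §R4, `StrategistS1.lean` §1;
`Theorems/FeketeScalesAssembly.lean` (pattern; `rpow_le_linear_add_const` reused); M. Fekete (1923) /
de Bruijn–Erdős (1952) for the shape of the lemma.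
-/

-- `Summit.<Summit>.<Problem>` is the mandated summit-side namespace (CONVENTIONS §2); for the
-- single-conjunct summit `ABC` the two coincide, so the duplicate `ABC.ABC` is deliberate.
set_option linter.dupNamespace false


namespace Summit.ABC.ABC.Theorems.ScaleSubmultiplicativity.NapAssembly

open Literature.NumberTheory.DiophantineGeometry

/-! ### Abstract iteration lemmas for a predicate `P S X` ("scale `S` is good with bound `X`")
under a NEAR-GOOD propagation hypothesis (one common exponent `l ∈ [1, 1 + δ₀]`). -/

/-- **Chain** (exact exponents). From a `(1+δ)`-good seed scale `R ≥ max R₀ 2`, near-good propagation at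
`(R^{k+1}, R)` gives `P (R^{k+1}) ((R^{k+1})^{1 + δ + k Δ})` with `Δ := (L + (log R)^θ)/log R`, as long as
the exponent stays in the window (`δ + Kc Δ ≤ δ₀`, `k ≤ Kc`): the slack of one step is
`L + ((k+2) log R)^θ ≤ (k+2)(L + (log R)^θ)`. [folklore] -/
theorem chain_exact (P : ℕ → ℝ → Prop) {θ L δ δ₀ : ℝ} {R₀ R Kc : ℕ}
    (hθ1 : θ ≤ 1) (hL : 0 ≤ L) (hδ : 0 ≤ δ) (hR₀ : R₀ ≤ R) (hR2 : 2 ≤ R)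
    (hwin : δ + (Kc : ℝ) * ((L + Real.log R ^ θ) / Real.log R) ≤ δ₀)
    (mono : ∀ S : ℕ, ∀ X Y : ℝ, P S X → X ≤ Y → P S Y)
    (nap : ∀ S₁ S₂ : ℕ, R₀ ≤ S₁ → R₀ ≤ S₂ → ∀ l : ℝ, 1 ≤ l → l ≤ 1 + δ₀ →
      P S₁ ((S₁ : ℝ) ^ l) → P S₂ ((S₂ : ℝ) ^ l) →
      P (S₁ * S₂) (Real.exp L * Real.exp (Real.log ((S₁ : ℝ) * S₂) ^ θ) * ((S₁ : ℝ) * S₂) ^ l))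
    (base : P R ((R : ℝ) ^ (1 + δ))) :
    ∀ k : ℕ, k ≤ Kc →
      P (R ^ (k + 1)) (((R ^ (k + 1) : ℕ) : ℝ) ^ (1 + δ + k * ((L + Real.log R ^ θ) / Real.log R))) := by
  set t : ℝ := Real.log R with ht_def
  set Δ : ℝ := (L + t ^ θ) / t with hΔ_def
  have hR1 : (1 : ℝ) < R := by exact_mod_cast hR2
  have hRpos : (0 : ℝ) < R := by positivity
  have ht : 0 < t := Real.log_pos hR1
  have htθ : 0 ≤ t ^ θ := Real.rpow_nonneg ht.le θ
  have hΔ0 : 0 ≤ Δ := div_nonneg (by linarith) ht.le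
  have hΔt : Δ * t = L + t ^ θ := by rw [hΔ_def]; field_simp
  intro k
  induction k with
  | zero =>
    intro _
    simpa using base
  | succ k ih =>
    intro hk
    have hk' : k ≤ Kc := Nat.le_of_succ_le hk
    have hP := ih hk'
    -- the common exponent
    set l : ℝ := 1 + δ + (k : ℝ) * Δ with hl_def
    have hkΔ : (k : ℝ) * Δ ≤ (Kc : ℝ) * Δ :=
      mul_le_mul_of_nonneg_right (by exact_mod_cast hk') hΔ0
    have hl1 : 1 ≤ l := by
      have : 0 ≤ (k : ℝ) * Δ := mul_nonneg (Nat.cast_nonneg k) hΔ0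
      rw [hl_def]; linarith
    have hlδ : 1 + δ ≤ l := by
      have : 0 ≤ (k : ℝ) * Δ := mul_nonneg (Nat.cast_nonneg k) hΔ0
      rw [hl_def]; linarith
    have hl2 : l ≤ 1 + δ₀ := by rw [hl_def]; linarith
    -- the seed at exponent `l`
    have hR1' : (1 : ℝ) ≤ R := hR1.le
    have hbase : P R ((R : ℝ) ^ l) :=
      mono _ _ _ base (Real.rpow_le_rpow_of_exponent_le hR1' hlδ)
    -- propagate
    have hS₁ : R₀ ≤ R ^ (k + 1) := hR₀.trans (Nat.le_self_pow (Nat.succ_ne_zero k) R)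
    have h := nap (R ^ (k + 1)) R hS₁ hR₀ l hl1 hl2 hP hbase
    have hpow : R ^ (k + 1) * R = R ^ (k + 1 + 1) := (pow_succ R (k + 1)).symm
    rw [hpow] at h
    refine mono _ _ _ h ?_
    -- compare the two bounds
    have hcast : ((R ^ (k + 1) : ℕ) : ℝ) * (R : ℝ) = ((R ^ (k + 1 + 1) : ℕ) : ℝ) := by
      push_cast; ring
    have hQpos : (0 : ℝ) < ((R ^ (k + 1 + 1) : ℕ) : ℝ) := by positivity
    have hlogQ : Real.log (((R ^ (k + 1 + 1) : ℕ) : ℝ)) = ((k : ℝ) + 2) * t := by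
      rw [Nat.cast_pow, Real.log_pow]; push_cast; ring
    rw [hcast, Real.rpow_def_of_pos hQpos, Real.rpow_def_of_pos hQpos, hlogQ, ← Real.exp_add,
      ← Real.exp_add, Real.exp_le_exp]
    -- goal: L + ((k+2) t)^θ + (k+2) t * l ≤ (k+2) t * (1 + δ + (k+1) Δ)
    have hk2 : (1 : ℝ) ≤ (k : ℝ) + 2 := by
      have : (0 : ℝ) ≤ k := Nat.cast_nonneg k
      linarith
    have hk2pos : (0 : ℝ) < (k : ℝ) + 2 := by linarith
    have hA : (((k : ℝ) + 2) * t) ^ θ ≤ ((k : ℝ) + 2) * t ^ θ := by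
      rw [Real.mul_rpow hk2pos.le ht.le]
      have : ((k : ℝ) + 2) ^ θ ≤ ((k : ℝ) + 2) ^ (1 : ℝ) :=
        Real.rpow_le_rpow_of_exponent_le hk2 hθ1
      rw [Real.rpow_one] at this
      exact mul_le_mul_of_nonneg_right this htθ
    have hB : L ≤ ((k : ℝ) + 2) * L := le_mul_of_one_le_left hL hk2
    have hcastk : ((k + 1 : ℕ) : ℝ) = (k : ℝ) + 1 := by push_cast; ring
    rw [hcastk]
    have key : L + (((k : ℝ) + 2) * t) ^ θ ≤ ((k : ℝ) + 2) * (Δ * t) := by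
      rw [hΔt]; nlinarith [hA, hB]
    nlinarith [key, hl1]

/-- **Chain** (uniform exponent). Under the hypotheses of `chain_exact`, every scale `R^{k+1}`,
`k ≤ Kc`, is good at the common exponent `1 + δ + Kc Δ`. [folklore] -/
theorem chain (P : ℕ → ℝ → Prop) {θ L δ δ₀ : ℝ} {R₀ R Kc : ℕ}
    (hθ1 : θ ≤ 1) (hL : 0 ≤ L) (hδ : 0 ≤ δ) (hR₀ : R₀ ≤ R) (hR2 : 2 ≤ R)
    (hwin : δ + (Kc : ℝ) * ((L + Real.log R ^ θ) / Real.log R) ≤ δ₀)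
    (mono : ∀ S : ℕ, ∀ X Y : ℝ, P S X → X ≤ Y → P S Y)
    (nap : ∀ S₁ S₂ : ℕ, R₀ ≤ S₁ → R₀ ≤ S₂ → ∀ l : ℝ, 1 ≤ l → l ≤ 1 + δ₀ →
      P S₁ ((S₁ : ℝ) ^ l) → P S₂ ((S₂ : ℝ) ^ l) →
      P (S₁ * S₂) (Real.exp L * Real.exp (Real.log ((S₁ : ℝ) * S₂) ^ θ) * ((S₁ : ℝ) * S₂) ^ l))
    (base : P R ((R : ℝ) ^ (1 + δ))) :
    ∀ k : ℕ, k ≤ Kc →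
      P (R ^ (k + 1)) (((R ^ (k + 1) : ℕ) : ℝ) ^ (1 + δ + Kc * ((L + Real.log R ^ θ) / Real.log R))) := by
  intro k hk
  have h := chain_exact P hθ1 hL hδ hR₀ hR2 hwin mono nap base k hk
  refine mono _ _ _ h (Real.rpow_le_rpow_of_exponent_le ?_ ?_)
  · have : 1 ≤ R ^ (k + 1) := Nat.one_le_pow _ _ (by omega)
    exact_mod_cast this
  · have hR1 : (1 : ℝ) < R := by exact_mod_cast hR2
    have ht : 0 < Real.log R := Real.log_pos hR1
    have hΔ0 : 0 ≤ (L + Real.log R ^ θ) / Real.log R :=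
      div_nonneg (by linarith [Real.rpow_nonneg ht.le θ]) ht.le
    have : (k : ℝ) * ((L + Real.log R ^ θ) / Real.log R) ≤ (Kc : ℝ) * ((L + Real.log R ^ θ) / Real.log R) :=
      mul_le_mul_of_nonneg_right (by exact_mod_cast hk) hΔ0
    linarith

/-- **Tower** (the doubling potential of `FeketeScalesAssembly.doubling`, run with one exponent).  From a
base scale `B ≥ max R₀ 2` that is good at exponent `b₀ ≥ 1`, near-good propagation at equal scales gives
`P (B^{2^i}) ((B^{2^i})^{l_i})` with `l_i := b₀ + (β/T)(1 - (2^i)^θ/2^i) ≤ b₀ + β/T`, `T = log B`, whenever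
`L + 2^θ T^θ ≤ β (2 - 2^θ)` and the window condition `b₀ + β/T ≤ 1 + δ₀` holds; stated with the uniform
exponent `b₀ + β/T`. [folklore] -/
theorem tower (P : ℕ → ℝ → Prop) {θ L δ₀ b₀ β : ℝ} {R₀ B : ℕ}
    (hθ0 : 0 ≤ θ) (hθ1 : θ ≤ 1) (hL : 0 ≤ L) (hβ0 : 0 ≤ β) (hb₀ : 1 ≤ b₀) (hR₀ : R₀ ≤ B) (hB2 : 2 ≤ B)
    (hβ : L + (2 : ℝ) ^ θ * Real.log B ^ θ ≤ β * (2 - (2 : ℝ) ^ θ))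
    (hwin : b₀ + β / Real.log B ≤ 1 + δ₀)
    (mono : ∀ S : ℕ, ∀ X Y : ℝ, P S X → X ≤ Y → P S Y)
    (nap : ∀ S₁ S₂ : ℕ, R₀ ≤ S₁ → R₀ ≤ S₂ → ∀ l : ℝ, 1 ≤ l → l ≤ 1 + δ₀ →
      P S₁ ((S₁ : ℝ) ^ l) → P S₂ ((S₂ : ℝ) ^ l) →
      P (S₁ * S₂) (Real.exp L * Real.exp (Real.log ((S₁ : ℝ) * S₂) ^ θ) * ((S₁ : ℝ) * S₂) ^ l))
    (base : P B ((B : ℝ) ^ b₀)) :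
    ∀ i : ℕ, P (B ^ 2 ^ i) (((B ^ 2 ^ i : ℕ) : ℝ) ^ (b₀ + β / Real.log B)) := by
  -- the exact potential `l i := b₀ + (β/T)(1 - (2^i)^θ/2^i)`, then weaken to `b₀ + β/T`
  suffices hex : ∀ i : ℕ, P (B ^ 2 ^ i) (((B ^ 2 ^ i : ℕ) : ℝ) ^
      (b₀ + β / Real.log B * (1 - ((2 : ℝ) ^ i) ^ θ / (2 : ℝ) ^ i))) by
    intro i
    refine mono _ _ _ (hex i) (Real.rpow_le_rpow_of_exponent_le ?_ ?_)
    · have : 1 ≤ B ^ 2 ^ i := Nat.one_le_pow _ _ (by omega)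
      exact_mod_cast this
    · have hB1 : (1 : ℝ) < B := by exact_mod_cast hB2
      have hT : 0 < Real.log B := Real.log_pos hB1
      have h2ipos : (0 : ℝ) < (2 : ℝ) ^ i := by positivity
      have hu0 : 0 ≤ ((2 : ℝ) ^ i) ^ θ / (2 : ℝ) ^ i :=
        div_nonneg (Real.rpow_nonneg h2ipos.le θ) h2ipos.le
      have : β / Real.log B * (1 - ((2 : ℝ) ^ i) ^ θ / (2 : ℝ) ^ i) ≤ β / Real.log B * 1 :=
        mul_le_mul_of_nonneg_left (by linarith) (div_nonneg hβ0 hT.le)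
      linarith
  set T : ℝ := Real.log B with hT_def
  have hB1 : (1 : ℝ) < B := by exact_mod_cast hB2
  have hBpos : (0 : ℝ) < B := by positivity
  have hT : 0 < T := Real.log_pos hB1
  have hTθ : 0 ≤ T ^ θ := Real.rpow_nonneg hT.le θ
  have hβT : 0 ≤ β / T := div_nonneg hβ0 hT.le
  -- the exponents `l i`
  set l : ℕ → ℝ := fun i => b₀ + β / T * (1 - ((2 : ℝ) ^ i) ^ θ / (2 : ℝ) ^ i) with hl_def
  -- `(2^i)^θ / 2^i ∈ [0, 1]`
  have hu : ∀ i : ℕ, 0 ≤ ((2 : ℝ) ^ i) ^ θ / (2 : ℝ) ^ i ∧ ((2 : ℝ) ^ i) ^ θ / (2 : ℝ) ^ i ≤ 1 := by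
    intro i
    have h2i : (1 : ℝ) ≤ (2 : ℝ) ^ i := one_le_pow₀ (by norm_num)
    have h2ipos : (0 : ℝ) < (2 : ℝ) ^ i := by positivity
    refine ⟨div_nonneg (Real.rpow_nonneg h2ipos.le θ) h2ipos.le, ?_⟩
    rw [div_le_one h2ipos]
    have := Real.rpow_le_rpow_of_exponent_le h2i hθ1
    rwa [Real.rpow_one] at this
  have hl_lo : ∀ i, b₀ ≤ l i := by
    intro i
    have := (hu i).2
    have : 0 ≤ β / T * (1 - ((2 : ℝ) ^ i) ^ θ / (2 : ℝ) ^ i) := mul_nonneg hβT (by linarith)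
    show b₀ ≤ b₀ + β / T * (1 - ((2 : ℝ) ^ i) ^ θ / (2 : ℝ) ^ i)
    linarith
  have hl_hi : ∀ i, l i ≤ b₀ + β / T := by
    intro i
    have h1 := (hu i).1
    have : β / T * (1 - ((2 : ℝ) ^ i) ^ θ / (2 : ℝ) ^ i) ≤ β / T * 1 :=
      mul_le_mul_of_nonneg_left (by linarith) hβT
    show b₀ + β / T * (1 - ((2 : ℝ) ^ i) ^ θ / (2 : ℝ) ^ i) ≤ b₀ + β / T
    linarith
  intro i
  induction i with
  | zero =>
    have hl0 : l 0 = b₀ := by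
      show b₀ + β / T * (1 - ((2 : ℝ) ^ 0) ^ θ / (2 : ℝ) ^ 0) = b₀
      simp
    show P (B ^ 2 ^ 0) (((B ^ 2 ^ 0 : ℕ) : ℝ) ^ l 0)
    rw [hl0]; simpa using base
  | succ i ih =>
    have hl1 : 1 ≤ l i := hb₀.trans (hl_lo i)
    have hl2 : l i ≤ 1 + δ₀ := (hl_hi i).trans hwin
    have hS : R₀ ≤ B ^ 2 ^ i := hR₀.trans (Nat.le_self_pow (pow_ne_zero _ two_ne_zero) B)
    have h := nap _ _ hS hS (l i) hl1 hl2 ih ih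
    have hpow : B ^ 2 ^ i * B ^ 2 ^ i = B ^ 2 ^ (i + 1) := by
      rw [← pow_add, ← two_mul, ← pow_succ']
    rw [hpow] at h
    refine mono _ _ _ h ?_
    -- compare the bounds at the scale `Q = B^{2^{i+1}}`
    have hcast : ((B ^ 2 ^ i : ℕ) : ℝ) * ((B ^ 2 ^ i : ℕ) : ℝ) = ((B ^ 2 ^ (i + 1) : ℕ) : ℝ) := by
      rw [← Nat.cast_mul, hpow]
    have hQpos : (0 : ℝ) < ((B ^ 2 ^ (i + 1) : ℕ) : ℝ) := by positivity
    have hlogQ : Real.log (((B ^ 2 ^ (i + 1) : ℕ) : ℝ)) = (2 : ℝ) ^ (i + 1) * T := by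
      rw [Nat.cast_pow, Real.log_pow]; push_cast; ring
    rw [hcast, Real.rpow_def_of_pos hQpos, Real.rpow_def_of_pos hQpos, hlogQ, ← Real.exp_add,
      ← Real.exp_add, Real.exp_le_exp]
    -- goal: L + (2^{i+1} T)^θ + 2^{i+1} T * l i ≤ 2^{i+1} T * l (i+1)
    set u : ℝ := ((2 : ℝ) ^ i) ^ θ with hu_def
    have h2i : (1 : ℝ) ≤ (2 : ℝ) ^ i := one_le_pow₀ (by norm_num)
    have h2ipos : (0 : ℝ) < (2 : ℝ) ^ i := by positivity
    have hu1 : 1 ≤ u := Real.one_le_rpow h2i hθ0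
    have h2θ : (0 : ℝ) < (2 : ℝ) ^ θ := by positivity
    -- `(2^{i+1})^θ = 2^θ u` and `(2^{i+1} T)^θ = 2^θ u T^θ`
    have hsplit : ((2 : ℝ) ^ (i + 1)) ^ θ = (2 : ℝ) ^ θ * u := by
      rw [pow_succ, Real.mul_rpow h2ipos.le (by norm_num), hu_def]; ring
    have hsplitT : ((2 : ℝ) ^ (i + 1) * T) ^ θ = (2 : ℝ) ^ θ * u * T ^ θ := by
      rw [Real.mul_rpow (by positivity) hT.le, hsplit]
    -- the gain `2^{i+1} T (l (i+1) - l i) = β u (2 - 2^θ)`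
    have hgain : (2 : ℝ) ^ (i + 1) * T * (l (i + 1) - l i) = β * u * (2 - (2 : ℝ) ^ θ) := by
      have hli : l i = b₀ + β / T * (1 - u / (2 : ℝ) ^ i) := rfl
      have hli1 : l (i + 1) = b₀ + β / T * (1 - ((2 : ℝ) ^ (i + 1)) ^ θ / (2 : ℝ) ^ (i + 1)) := rfl
      rw [hli, hli1, hsplit, pow_succ]
      field_simp
      ring
    rw [hsplitT]
    have hβu := mul_le_mul_of_nonneg_right hβ (zero_le_one.trans hu1)
    have hLu : L ≤ L * u := le_mul_of_one_le_right hL hu1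
    nlinarith [hgain, hβu, hLu, mul_nonneg h2θ.le hTθ]

/-- **Cover.** Every `N ≥ M ≥ 1` satisfies `N ≤ m · 2^i ≤ N + N / M` for some `m ∈ [M, 2M]` and `i`
(`i = ⌊log₂ (N/M)⌋`, `m = ⌊N / 2^i⌋ + 1`). [folklore] -/
theorem cover {M N : ℕ} (hM : 1 ≤ M) (hN : M ≤ N) :
    ∃ m i : ℕ, M ≤ m ∧ m ≤ 2 * M ∧ N ≤ m * 2 ^ i ∧ m * 2 ^ i ≤ N + N / M := by
  have hM0 : 0 < M := hM
  have hNM : 0 < N / M := Nat.div_pos hN hM0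
  set i : ℕ := Nat.log 2 (N / M) with hi_def
  have h1 : 2 ^ i ≤ N / M := Nat.pow_log_le_self 2 hNM.ne'
  have h2 : N / M < 2 ^ (i + 1) := Nat.lt_pow_succ_log_self one_lt_two _
  have h2i : 0 < 2 ^ i := Nat.two_pow_pos i
  -- `M * 2^i ≤ N` and `N < 2M * 2^i`
  have hlo : M * 2 ^ i ≤ N := by
    have := (Nat.le_div_iff_mul_le hM0).mp h1
    rwa [mul_comm] at this
  have hhi : N < 2 * M * 2 ^ i := by
    have h3 : N < (N / M + 1) * M := by
      have := Nat.lt_div_mul_add (a := N) hM0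
      linarith [Nat.div_mul_le_self N M]
    have h4 : (N / M + 1) * M ≤ 2 ^ (i + 1) * M := Nat.mul_le_mul_right M h2
    calc N < (N / M + 1) * M := h3
      _ ≤ 2 ^ (i + 1) * M := h4
      _ = 2 * M * 2 ^ i := by rw [pow_succ]; ring
  refine ⟨N / 2 ^ i + 1, i, ?_, ?_, ?_, ?_⟩
  · -- `M ≤ N / 2^i + 1`
    have : M ≤ N / 2 ^ i := (Nat.le_div_iff_mul_le h2i).mpr hlo
    omega
  · -- `N / 2^i + 1 ≤ 2M`
    have : N / 2 ^ i < 2 * M := (Nat.div_lt_iff_lt_mul h2i).mpr hhi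
    omega
  · -- `N ≤ (N / 2^i + 1) * 2^i`
    have := Nat.lt_div_mul_add (a := N) h2i
    rw [Nat.add_mul, one_mul]
    exact this.le
  · -- `(N / 2^i + 1) * 2^i ≤ N + N / M`
    rw [Nat.add_mul, one_mul]
    exact Nat.add_le_add (Nat.div_mul_le_self N (2 ^ i)) h1

/-- **Linear domination of the slack.** For `0 ≤ θ < 1`, `L`, `A ≥ 0` and any slope `κ > 0` there is
a threshold `T₀` beyond which `L + A t^θ ≤ κ t`. [folklore] -/
theorem slack_le_linear {θ L A κ : ℝ} (hθ0 : 0 ≤ θ) (hθ1 : θ < 1) (hA : 0 ≤ A) (hκ : 0 < κ) :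
    ∃ T₀ : ℝ, ∀ t : ℝ, 0 ≤ t → T₀ ≤ t → L + A * t ^ θ ≤ κ * t := by
  obtain ⟨B₁, -, hB₁⟩ :=
    FeketeScalesAssembly.rpow_le_linear_add_const hθ0 hθ1 (a := κ / (2 * (A + 1))) (by positivity)
  refine ⟨2 * (L + (A + 1) * B₁) / κ, fun t ht hTt => ?_⟩
  have h1 : A * t ^ θ ≤ (A + 1) * t ^ θ :=
    mul_le_mul_of_nonneg_right (by linarith) (Real.rpow_nonneg ht θ)
  have h2 := mul_le_mul_of_nonneg_left (hB₁ t ht) (by linarith : (0 : ℝ) ≤ A + 1)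
  have e : (A + 1) * (κ / (2 * (A + 1)) * t + B₁) = κ / 2 * t + (A + 1) * B₁ := by
    field_simp
  have h3 : κ / 2 * (2 * (L + (A + 1) * B₁) / κ) = L + (A + 1) * B₁ := by field_simp
  have h4 := mul_le_mul_of_nonneg_left hTt (by positivity : (0 : ℝ) ≤ κ / 2)
  nlinarith [h1, h2, e, h3, h4]

/-- **Normalisation of near-good propagation.** From NAP data `(θ, K, R₀)` one may pass to
`θ' = max θ 0`, `K' = e^{max (log K) 0}` and thresholds `max R₀ 2` (then `log (R₁R₂) ≥ 1`). [folklore] -/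
theorem nap_normalise (P : ℕ → ℝ → Prop) {θ K δ₀ : ℝ} {R₀ : ℕ} (hK : 0 < K)
    (mono : ∀ S : ℕ, ∀ X Y : ℝ, P S X → X ≤ Y → P S Y)
    (h : ∀ R₁ R₂ : ℕ, R₀ ≤ R₁ → R₀ ≤ R₂ → ∀ l : ℝ, 1 ≤ l → l ≤ 1 + δ₀ →
      P R₁ ((R₁ : ℝ) ^ l) → P R₂ ((R₂ : ℝ) ^ l) →
      P (R₁ * R₂) (K * Real.exp (Real.log ((R₁ : ℝ) * R₂) ^ θ) * ((R₁ : ℝ) * R₂) ^ l)) :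
    ∀ R₁ R₂ : ℕ, max R₀ 2 ≤ R₁ → max R₀ 2 ≤ R₂ → ∀ l : ℝ, 1 ≤ l → l ≤ 1 + δ₀ →
      P R₁ ((R₁ : ℝ) ^ l) → P R₂ ((R₂ : ℝ) ^ l) →
      P (R₁ * R₂) (Real.exp (max (Real.log K) 0) *
        Real.exp (Real.log ((R₁ : ℝ) * R₂) ^ (max θ 0)) * ((R₁ : ℝ) * R₂) ^ l) := by
  intro R₁ R₂ hR₁ hR₂ l hl1 hl2 g₁ g₂
  have hP := h R₁ R₂ ((le_max_left _ _).trans hR₁) ((le_max_left _ _).trans hR₂) l hl1 hl2 g₁ g₂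
  refine mono _ _ _ hP ?_
  have h2R₁ : (2 : ℝ) ≤ R₁ := by exact_mod_cast (le_max_right _ _).trans hR₁
  have h2R₂ : (2 : ℝ) ≤ R₂ := by exact_mod_cast (le_max_right _ _).trans hR₂
  have hlog : 1 ≤ Real.log ((R₁ : ℝ) * R₂) := by
    rw [Real.le_log_iff_exp_le (by positivity)]
    have he : Real.exp 1 < 3 := Real.exp_one_lt_three
    nlinarith
  have hK' : K ≤ Real.exp (max (Real.log K) 0) := by
    calc K = Real.exp (Real.log K) := (Real.exp_log hK).symm
      _ ≤ Real.exp (max (Real.log K) 0) := Real.exp_le_exp.2 (le_max_left _ _)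
  have hθ' : Real.exp (Real.log ((R₁ : ℝ) * R₂) ^ θ) ≤
      Real.exp (Real.log ((R₁ : ℝ) * R₂) ^ (max θ 0)) :=
    Real.exp_le_exp.2 (Real.rpow_le_rpow_of_exponent_le hlog (le_max_left _ _))
  have hPl : 0 ≤ ((R₁ : ℝ) * R₂) ^ l := Real.rpow_nonneg (by positivity) l
  gcongr

end Summit.ABC.ABC.Theorems.ScaleSubmultiplicativity.NapAssembly

namespace Summit.ABC.ABC.Theorems

open Literature.NumberTheory.DiophantineGeometry

/-- **crux ⟹ NAP.** `ScaleSubmultiplicativity` implies near-good propagation in every window `δ₀`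
(here `δ₀ = 1`): the shadows `(aᵢ, bᵢ, cᵢ)` at the scales `R₁, R₂` are bounded by the goodness bounds
`Rᵢ^l`, and `R₁^l R₂^l = (R₁R₂)^l`.  (Crux-strategist s1, `StrategistS1.nap_of_scaleSubmultiplicativity`,
restated over tree vocabulary with `Good` inlined.) [folklore] -/
theorem ScaleSubmultiplicativity.nap_of_scaleSubmultiplicativity :
    Summit.ABC.ABC.Theses.FeketeScales.ScaleSubmultiplicativity →
    ∃ δ₀ : ℝ, 0 < δ₀ ∧ ∃ θ : ℝ, θ < 1 ∧ ∃ K : ℝ, 0 < K ∧ ∃ R₀ : ℕ, ∀ R₁ R₂ : ℕ, R₀ ≤ R₁ → R₀ ≤ R₂ →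
      ∀ l : ℝ, 1 ≤ l → l ≤ 1 + δ₀ →
      (∀ a b c : ℕ, IsABCTriple a b c → rad a b c ≤ R₁ → (c : ℝ) ≤ (R₁ : ℝ) ^ l) →
      (∀ a b c : ℕ, IsABCTriple a b c → rad a b c ≤ R₂ → (c : ℝ) ≤ (R₂ : ℝ) ^ l) →
      ∀ a b c : ℕ, IsABCTriple a b c → rad a b c ≤ R₁ * R₂ →
        (c : ℝ) ≤ K * Real.exp (Real.log ((R₁ : ℝ) * R₂) ^ θ) * ((R₁ : ℝ) * R₂) ^ l := by
  rintro ⟨θ, hθ, K, hK, R₀, h⟩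
  refine ⟨1, one_pos, θ, hθ, K, hK, R₀, ?_⟩
  intro R₁ R₂ hR₁ hR₂ l _ _ g₁ g₂ a b c habc hrad
  obtain ⟨a₁, b₁, c₁, a₂, b₂, c₂, t₁, r₁, t₂, r₂, hle⟩ := h R₁ R₂ hR₁ hR₂ a b c habc hrad
  have hc₁ : (c₁ : ℝ) ≤ (R₁ : ℝ) ^ l := g₁ a₁ b₁ c₁ t₁ r₁
  have hc₂ : (c₂ : ℝ) ≤ (R₂ : ℝ) ^ l := g₂ a₂ b₂ c₂ t₂ r₂
  have hc₁0 : (0 : ℝ) ≤ c₁ := Nat.cast_nonneg _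
  have hc₂0 : (0 : ℝ) ≤ c₂ := Nat.cast_nonneg _
  have hs : 0 ≤ K * Real.exp (Real.log ((R₁ : ℝ) * R₂) ^ θ) := mul_nonneg hK.le (Real.exp_pos _).le
  rw [Real.mul_rpow (Nat.cast_nonneg R₁) (Nat.cast_nonneg R₂)]
  calc (c : ℝ) ≤ K * Real.exp (Real.log ((R₁ : ℝ) * R₂) ^ θ) * c₁ * c₂ := hle
    _ ≤ K * Real.exp (Real.log ((R₁ : ℝ) * R₂) ^ θ) * (R₁ : ℝ) ^ l * (R₂ : ℝ) ^ l :=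
        mul_le_mul (mul_le_mul_of_nonneg_left hc₁ hs) hc₂ hc₂0 (mul_nonneg hs (hc₁0.trans hc₁))
    _ = K * Real.exp (Real.log ((R₁ : ℝ) * R₂) ^ θ) * ((R₁ : ℝ) ^ l * (R₂ : ℝ) ^ l) := by ring

end Summit.ABC.ABC.Theorems
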